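import Summits.BirchSwinnertonDyer.BirchSwinnertonDyer.Theorems.PrintCFramBottomClassIndexLawFiveLeHeegnerFamilySupply
import HarnessLib

/-!
# Crux `PrintCFram.BottomClassIndexLawFiveLe` (stmt-BirchSwinnertonDyer-20372), line `eisenstein-resource-bdp-line` (registry v19):
# THE SUPPLY STATEMENT AT THE SIX LEAF PRIMES ONLY — Stub C ⟸ `(P⁶)` ⟸ `(P⁶_fam)`, where `p` ranges over `{7, 11, 19, 43, 67, 163}`
# (so `k` over the twelve values `(p+1)/4, (3p−1)/4`), not over all primes `≥ 5`
# (cell `bsd-print-cfram`, width seat `bsd-line-cfram-p1-w8` g4; THEOREMS ONLY, `--supports` 20372; BSD is not proved by any of this)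

HONEST FRAMING. A sharpening of the hypothesis of `HeegnerFieldSupply.stubC_of_splitPrimes_bernoulliUnit` (`(P) ⟹ C`, p676235) and of
`…stubC_of_heegnerFamily_bernoulliUnit` (`(P_fam) ⟹ C`): Stub C's binders (`W` CM, `CMRamified W p`, `p ≥ 5`) force
`p ∈ {7, 11, 19, 43, 67, 163}` (`X12.eq_of_dvd_cmFieldDiscrOfJ`: the CM field is `ℚ(√−p)` of class number one), so the supplier of the
analytic item only owes the six leaf primes: `(P⁶)` / `(P⁶_fam)` = `(P)` / `(P_fam)` with «`5 ≤ p`» replaced by the six-prime disjunction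
(weaker statements: `(P) ⟹ (P⁶)`, §1). Twelve weights `k + 1 ∈ {3, 6; 4, 9; 6, 15; 12, 33; 18, 51; 42, 123}` for the modular-forms reading of
the crux notes. Nothing here proves `(P⁶)`. beyond-print theorem: NO. References: [KrizLi2019] Thm. 1.20, §8; [SilvermanATAEC1994] App. A §3
(the thirteen CM `j`-invariants); [Cox2013] §7.A, Prop. 5.16.
-/

set_option autoImplicit false
-- summit-side namespace `Summit.BirchSwinnertonDyer.BirchSwinnertonDyer.…` (single-conjunct summit, D-0017 layout)
set_option linter.dupNamespace false

noncomputable section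

open scoped Classical
open NumberField WeierstrassCurve DirichletCharacter Literature.NumberTheory.LFunctions
  Literature.NumberTheory.EllipticCurves Literature.NumberTheory.EllipticCurves.KrizLi2019
  Literature.NumberTheory.EllipticCurves.Rank1Residual
open Literature.NumberTheory.Congruences Literature.NumberTheory.QuadraticFields

namespace Summit.BirchSwinnertonDyer.BirchSwinnertonDyer.Theorems.PrintCFram.HeegnerFieldSupply

open Summit.BirchSwinnertonDyer.BirchSwinnertonDyer.Theorems.PrintCFram
open Summit.BirchSwinnertonDyer.BirchSwinnertonDyer.Theorems.PrintCFram.KummerDictionary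
open Summit.BirchSwinnertonDyer.BirchSwinnertonDyer.Theorems.PrintCFram.HeegnerFamily
open Summit.BirchSwinnertonDyer.Rank1Residual Summit.BirchSwinnertonDyer.Rank1Residual.X12.O11

/-! ## §1 `(P) ⟹ (P⁶)` (the six-prime form is weaker) -/

/-- **`(P) ⟹ (P⁶)`**: restricting the supply statement to `p ∈ {7, 11, 19, 43, 67, 163}` only weakens it. [folklore] -/
theorem splitPrimes_bernoulliUnit_six_of_splitPrimes
    (hP : ∀ (p : ℕ) [Fact p.Prime] (m : ℕ) [NeZero m] (χ : DirichletCharacter ℚ_[p] m) (k : ℕ),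
      5 ≤ p → m.Coprime p → χ.IsPrimitive → χ.IsQuadratic → (k = (p + 1) / 4 ∨ k = (3 * p - 1) / 4) →
      2 ≤ k → k ≤ p - 2 → χ (-1) * (-1) ^ k = -1 →
      ¬ ‖((p - k : ℕ) : ℚ_[p])⁻¹ * generalizedBernoulli (p - k) χ‖ ≤ (p : ℝ)⁻¹ →
      ∃ (K : Type) (_ : Field K) (_ : NumberField K) (εK : DirichletCharacter ℚ_[p] (NumberField.discr K).natAbs),
        IsImaginaryQuadratic K ∧
        (∀ q : ℕ, q.Prime → q ∣ p * m → ((Ideal.span {(q : ℤ)}).primesOver (𝓞 K)).ncard = 2) ∧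
        Odd (NumberField.discr K) ∧ NumberField.discr K < -4 ∧ IsKroneckerCharacterOf K εK ∧
        ¬ ‖(k : ℚ_[p])⁻¹ * @generalizedBernoulli ℚ_[p] _ _
            (changeLevel (dvd_mul_right m (NumberField.discr K).natAbs) χ *
              changeLevel (dvd_mul_left (NumberField.discr K).natAbs m) εK).conductor ⟨conductor_ne_zero _⟩ k
            (changeLevel (dvd_mul_right m (NumberField.discr K).natAbs) χ *
              changeLevel (dvd_mul_left (NumberField.discr K).natAbs m) εK).primitiveCharacter‖ ≤ (p : ℝ)⁻¹) :
    ∀ (p : ℕ) [Fact p.Prime] (m : ℕ) [NeZero m] (χ : DirichletCharacter ℚ_[p] m) (k : ℕ),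
      (p = 7 ∨ p = 11 ∨ p = 19 ∨ p = 43 ∨ p = 67 ∨ p = 163) →
      m.Coprime p → χ.IsPrimitive → χ.IsQuadratic → (k = (p + 1) / 4 ∨ k = (3 * p - 1) / 4) →
      2 ≤ k → k ≤ p - 2 → χ (-1) * (-1) ^ k = -1 →
      ¬ ‖((p - k : ℕ) : ℚ_[p])⁻¹ * generalizedBernoulli (p - k) χ‖ ≤ (p : ℝ)⁻¹ →
      ∃ (K : Type) (_ : Field K) (_ : NumberField K) (εK : DirichletCharacter ℚ_[p] (NumberField.discr K).natAbs),
        IsImaginaryQuadratic K ∧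
        (∀ q : ℕ, q.Prime → q ∣ p * m → ((Ideal.span {(q : ℤ)}).primesOver (𝓞 K)).ncard = 2) ∧
        Odd (NumberField.discr K) ∧ NumberField.discr K < -4 ∧ IsKroneckerCharacterOf K εK ∧
        ¬ ‖(k : ℚ_[p])⁻¹ * @generalizedBernoulli ℚ_[p] _ _
            (changeLevel (dvd_mul_right m (NumberField.discr K).natAbs) χ *
              changeLevel (dvd_mul_left (NumberField.discr K).natAbs m) εK).conductor ⟨conductor_ne_zero _⟩ k
            (changeLevel (dvd_mul_right m (NumberField.discr K).natAbs) χ *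
              changeLevel (dvd_mul_left (NumberField.discr K).natAbs m) εK).primitiveCharacter‖ ≤ (p : ℝ)⁻¹ :=
  fun p _ m _ χ k hp6 hmp hχ hχq hk hk2 hkp hpar hcls ↦
    hP p m χ k (by rcases hp6 with h | h | h | h | h | h <;> omega) hmp hχ hχq hk hk2 hkp hpar hcls

/-! ## §2 Stub C from `(P⁶)` -/

/-- **Stub C VERBATIM ⟸ `(P⁶)`, the supply statement at the six leaf primes `7, 11, 19, 43, 67, 163` only.** The crux's binders force
`p ∣ d_K = cmFieldDiscrOfJ(j(W))` with `p ≥ 5`, hence `p ∈ {7, 11, 19, 43, 67, 163}` (`X12.eq_of_dvd_cmFieldDiscrOfJ`); then as in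
`stubC_of_splitPrimes_bernoulliUnit`. [cite: KrizLi2019, Thm. 1.20 (p. 8) and §8 (pp. 49–52)] [cite: SilvermanATAEC1994, App. A §3] -/
theorem stubC_of_splitPrimes_bernoulliUnit_six
    (hP : ∀ (p : ℕ) [Fact p.Prime] (m : ℕ) [NeZero m] (χ : DirichletCharacter ℚ_[p] m) (k : ℕ),
      (p = 7 ∨ p = 11 ∨ p = 19 ∨ p = 43 ∨ p = 67 ∨ p = 163) →
      m.Coprime p → χ.IsPrimitive → χ.IsQuadratic → (k = (p + 1) / 4 ∨ k = (3 * p - 1) / 4) →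
      2 ≤ k → k ≤ p - 2 → χ (-1) * (-1) ^ k = -1 →
      ¬ ‖((p - k : ℕ) : ℚ_[p])⁻¹ * generalizedBernoulli (p - k) χ‖ ≤ (p : ℝ)⁻¹ →
      ∃ (K : Type) (_ : Field K) (_ : NumberField K) (εK : DirichletCharacter ℚ_[p] (NumberField.discr K).natAbs),
        IsImaginaryQuadratic K ∧
        (∀ q : ℕ, q.Prime → q ∣ p * m → ((Ideal.span {(q : ℤ)}).primesOver (𝓞 K)).ncard = 2) ∧
        Odd (NumberField.discr K) ∧ NumberField.discr K < -4 ∧ IsKroneckerCharacterOf K εK ∧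
        ¬ ‖(k : ℚ_[p])⁻¹ * @generalizedBernoulli ℚ_[p] _ _
            (changeLevel (dvd_mul_right m (NumberField.discr K).natAbs) χ *
              changeLevel (dvd_mul_left (NumberField.discr K).natAbs m) εK).conductor ⟨conductor_ne_zero _⟩ k
            (changeLevel (dvd_mul_right m (NumberField.discr K).natAbs) χ *
              changeLevel (dvd_mul_left (NumberField.discr K).natAbs m) εK).primitiveCharacter‖ ≤ (p : ℝ)⁻¹) :
    ∀ (W : WeierstrassCurve ℚ) [W.IsElliptic] [W.IsGloballyMinimal] (p : ℕ) [Fact p.Prime], W.HasCM → CMRamified W p → 5 ≤ p →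
      W.analyticRank = 1 → ∀ (f : ℕ) [NeZero f] (ψ : DirichletCharacter ℚ_[p] f) (ω : DirichletCharacter ℚ_[p] p), ψ.Odd →
      IsTeichmullerCharacter ω →
      (∀ ℓ : ℕ, ℓ.Prime → ¬ (ℓ ∣ p * W.conductorNorm ℤ) →
        ‖((W.LFunction ℓ : ℤ) : ℚ_[p]) - (ψ (ℓ : ZMod f) + ψ⁻¹ (ℓ : ZMod f) * ω (ℓ : ZMod p))‖ < 1) →
      ¬ ‖bernoulliOnePrim ψ⁻¹‖ ≤ (p : ℝ)⁻¹ →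
      ∃ (K : Type) (_ : Field K) (_ : NumberField K) (εK : DirichletCharacter ℚ_[p] (NumberField.discr K).natAbs),
        IsImaginaryQuadratic K ∧ SatisfiesHeegnerHypothesis (W.conductorNorm ℤ) K ∧ Odd (NumberField.discr K) ∧
        NumberField.discr K < -4 ∧ IsKroneckerCharacterOf K εK ∧
        ¬ ‖bernoulliOnePrim (bernoulliCharTwo ψ εK ω)‖ ≤ (p : ℝ)⁻¹ := by
  intro W _ _ p hp hCM hram h5 _hr f _ ψ ω hψ hω hss hcls
  have hp6 : p = 7 ∨ p = 11 ∨ p = 19 ∨ p = 43 ∨ p = 67 ∨ p = 163 := (X12.eq_of_dvd_cmFieldDiscrOfJ W hCM hp.out h5 hram).1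
  obtain ⟨m, hm, χ, ε, k, hmp, hχ, hχq, hε, hk, hk2, hkp, hpar, htr, hgoodW⟩ :=
    KrizLiBinders.exists_krizLiData_of_cmRamified W hCM hram h5
  haveI := hm
  have hclsB : ¬ ‖((p - k : ℕ) : ℚ_[p])⁻¹ * generalizedBernoulli (p - k) χ‖ ≤ (p : ℝ)⁻¹ := fun h ↦
    hcls ((norm_bernoulliOnePrim_inv_le_inv_iff_of_hss W χ ε k ω ψ h5 hχ hχq hmp (fun ℓ _ _ ↦ hε ℓ) hk2 hkp hpar htr
      hgoodW hω hψ hss).mpr h)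
  obtain ⟨K, iK, iK', εK, hK, hsplit, hoddK, hd4, hεK, hfld⟩ := hP p m χ k hp6 hmp hχ hχq hk hk2 hkp hpar hclsB
  have hH : SatisfiesHeegnerHypothesis (W.conductorNorm ℤ) K :=
    satisfiesHeegnerHypothesis_of_split_of_classData W hgoodW K hsplit
  refine ⟨K, iK, iK', εK, hK, hH, hoddK, hd4, hεK, fun h ↦ hfld ?_⟩
  exact (norm_bernoulliOnePrim_bernoulliCharTwo_le_inv_iff_of_heegner W χ ε k ω ψ hCM hram h5 hχ hχq hmp (fun ℓ _ _ ↦ hε ℓ)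
    hk2 hkp hpar htr hgoodW hω hψ hss K hK hH εK).mp h

/-! ## §3 Stub C from `(P⁶_fam)` -/

/-- **`(P⁶_fam) ⟹ (P⁶)`**: the Heegner-family form at the six primes implies the split-primes form at the six primes (the proof of
`splitPrimes_bernoulliUnit_of_heegnerFamily` with the six-prime hypothesis threaded through). [cite: Cox2013, §7.A (7.2)–(7.3) and Prop. 5.16] -/
theorem splitPrimes_bernoulliUnit_six_of_heegnerFamily_six
    (hF : ∀ (p : ℕ) [Fact p.Prime] (m : ℕ) [NeZero m] (χ : DirichletCharacter ℚ_[p] m) (k : ℕ),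
      (p = 7 ∨ p = 11 ∨ p = 19 ∨ p = 43 ∨ p = 67 ∨ p = 163) →
      m.Coprime p → χ.IsPrimitive → χ.IsQuadratic → (k = (p + 1) / 4 ∨ k = (3 * p - 1) / 4) →
      2 ≤ k → k ≤ p - 2 → χ (-1) * (-1) ^ k = -1 →
      ¬ ‖((p - k : ℕ) : ℚ_[p])⁻¹ * generalizedBernoulli (p - k) χ‖ ≤ (p : ℝ)⁻¹ →
      ∃ (n t F : ℤ) (K : Type) (_ : Field K) (_ : NumberField K)
        (εK : DirichletCharacter ℚ_[p] (NumberField.discr K).natAbs),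
        Module.finrank ℚ K = 2 ∧ NumberField.discr K * F ^ 2 = t ^ 2 - 4 * n ∧ t ^ 2 < 4 * n ∧
        ((p * m : ℕ) : ℤ) ∣ n ∧ IsCoprime t ((2 * p * m : ℕ) : ℤ) ∧ NumberField.discr K ≠ -3 ∧
        IsKroneckerCharacterOf K εK ∧
        ¬ ‖(k : ℚ_[p])⁻¹ * @generalizedBernoulli ℚ_[p] _ _
            (changeLevel (dvd_mul_right m (NumberField.discr K).natAbs) χ *
              changeLevel (dvd_mul_left (NumberField.discr K).natAbs m) εK).conductor ⟨conductor_ne_zero _⟩ k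
            (changeLevel (dvd_mul_right m (NumberField.discr K).natAbs) χ *
              changeLevel (dvd_mul_left (NumberField.discr K).natAbs m) εK).primitiveCharacter‖ ≤ (p : ℝ)⁻¹) :
    ∀ (p : ℕ) [Fact p.Prime] (m : ℕ) [NeZero m] (χ : DirichletCharacter ℚ_[p] m) (k : ℕ),
      (p = 7 ∨ p = 11 ∨ p = 19 ∨ p = 43 ∨ p = 67 ∨ p = 163) →
      m.Coprime p → χ.IsPrimitive → χ.IsQuadratic → (k = (p + 1) / 4 ∨ k = (3 * p - 1) / 4) →
      2 ≤ k → k ≤ p - 2 → χ (-1) * (-1) ^ k = -1 →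
      ¬ ‖((p - k : ℕ) : ℚ_[p])⁻¹ * generalizedBernoulli (p - k) χ‖ ≤ (p : ℝ)⁻¹ →
      ∃ (K : Type) (_ : Field K) (_ : NumberField K) (εK : DirichletCharacter ℚ_[p] (NumberField.discr K).natAbs),
        IsImaginaryQuadratic K ∧
        (∀ q : ℕ, q.Prime → q ∣ p * m → ((Ideal.span {(q : ℤ)}).primesOver (𝓞 K)).ncard = 2) ∧
        Odd (NumberField.discr K) ∧ NumberField.discr K < -4 ∧ IsKroneckerCharacterOf K εK ∧
        ¬ ‖(k : ℚ_[p])⁻¹ * @generalizedBernoulli ℚ_[p] _ _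
            (changeLevel (dvd_mul_right m (NumberField.discr K).natAbs) χ *
              changeLevel (dvd_mul_left (NumberField.discr K).natAbs m) εK).conductor ⟨conductor_ne_zero _⟩ k
            (changeLevel (dvd_mul_right m (NumberField.discr K).natAbs) χ *
              changeLevel (dvd_mul_left (NumberField.discr K).natAbs m) εK).primitiveCharacter‖ ≤ (p : ℝ)⁻¹ := by
  intro p _ m _ χ k hp6 hmp hχ hχq hk hk2 hkp hpar hcls
  obtain ⟨n, t, F, K, iK, iK', εK, h2, h, hlt, hMn, hMt, h3, hεK, hfld⟩ := hF p m χ k hp6 hmp hχ hχq hk hk2 hkp hpar hcls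
  have ht : _root_.Odd t :=
    odd_of_isCoprime_two_mul (M := ((p * m : ℕ) : ℤ)) (by push_cast at hMt ⊢; simpa [mul_assoc] using hMt)
  refine ⟨K, iK, iK', εK, isImaginaryQuadratic_of_discr_mul_sq_eq h2 h hlt, fun q hq hqpm ↦ ?_, odd_of_mul_sq_eq h ht,
    discr_lt_neg_four_of_discr_mul_sq_eq h2 h ht hlt h3, hεK, hfld⟩
  have hq2pm : q ∣ 2 * p * m := by rw [mul_assoc]; exact dvd_mul_of_dvd_right hqpm 2
  exact ncard_primesOver_eq_two_of_dvd_of_not_dvd h2 h hq ((Int.natCast_dvd_natCast.mpr hqpm).trans hMn)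
    (not_dvd_of_isCoprime hMt hq hq2pm)

/-- **Stub C VERBATIM ⟸ `(P⁶_fam)`**: for each of the six leaf primes `p`, each `m ⊥ p`, each primitive quadratic `χ` mod `m` and the
sign-determined `k ∈ {(p+1)/4, (3p−1)/4}` (unit class factor available): ONE index `n ∈ pm·ℤ`, ONE `t` prime to `2pm` with `t² < 4n`,
a quadratic field `K` with `d_K·F² = t² − 4n`, `d_K ≠ −3`, a Kronecker `ε_K`, and `p ∤ B_{k,(χ·ε_K)~}/k`.
[cite: KrizLi2019, Thm. 1.20 (p. 8) and §8 (pp. 49–52)] [cite: Cox2013, §7.A (7.2)–(7.3) and Prop. 5.16] -/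
theorem stubC_of_heegnerFamily_bernoulliUnit_six
    (hF : ∀ (p : ℕ) [Fact p.Prime] (m : ℕ) [NeZero m] (χ : DirichletCharacter ℚ_[p] m) (k : ℕ),
      (p = 7 ∨ p = 11 ∨ p = 19 ∨ p = 43 ∨ p = 67 ∨ p = 163) →
      m.Coprime p → χ.IsPrimitive → χ.IsQuadratic → (k = (p + 1) / 4 ∨ k = (3 * p - 1) / 4) →
      2 ≤ k → k ≤ p - 2 → χ (-1) * (-1) ^ k = -1 →
      ¬ ‖((p - k : ℕ) : ℚ_[p])⁻¹ * generalizedBernoulli (p - k) χ‖ ≤ (p : ℝ)⁻¹ →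
      ∃ (n t F : ℤ) (K : Type) (_ : Field K) (_ : NumberField K)
        (εK : DirichletCharacter ℚ_[p] (NumberField.discr K).natAbs),
        Module.finrank ℚ K = 2 ∧ NumberField.discr K * F ^ 2 = t ^ 2 - 4 * n ∧ t ^ 2 < 4 * n ∧
        ((p * m : ℕ) : ℤ) ∣ n ∧ IsCoprime t ((2 * p * m : ℕ) : ℤ) ∧ NumberField.discr K ≠ -3 ∧
        IsKroneckerCharacterOf K εK ∧
        ¬ ‖(k : ℚ_[p])⁻¹ * @generalizedBernoulli ℚ_[p] _ _
            (changeLevel (dvd_mul_right m (NumberField.discr K).natAbs) χ *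
              changeLevel (dvd_mul_left (NumberField.discr K).natAbs m) εK).conductor ⟨conductor_ne_zero _⟩ k
            (changeLevel (dvd_mul_right m (NumberField.discr K).natAbs) χ *
              changeLevel (dvd_mul_left (NumberField.discr K).natAbs m) εK).primitiveCharacter‖ ≤ (p : ℝ)⁻¹) :
    ∀ (W : WeierstrassCurve ℚ) [W.IsElliptic] [W.IsGloballyMinimal] (p : ℕ) [Fact p.Prime], W.HasCM → CMRamified W p → 5 ≤ p →
      W.analyticRank = 1 → ∀ (f : ℕ) [NeZero f] (ψ : DirichletCharacter ℚ_[p] f) (ω : DirichletCharacter ℚ_[p] p), ψ.Odd →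
      IsTeichmullerCharacter ω →
      (∀ ℓ : ℕ, ℓ.Prime → ¬ (ℓ ∣ p * W.conductorNorm ℤ) →
        ‖((W.LFunction ℓ : ℤ) : ℚ_[p]) - (ψ (ℓ : ZMod f) + ψ⁻¹ (ℓ : ZMod f) * ω (ℓ : ZMod p))‖ < 1) →
      ¬ ‖bernoulliOnePrim ψ⁻¹‖ ≤ (p : ℝ)⁻¹ →
      ∃ (K : Type) (_ : Field K) (_ : NumberField K) (εK : DirichletCharacter ℚ_[p] (NumberField.discr K).natAbs),
        IsImaginaryQuadratic K ∧ SatisfiesHeegnerHypothesis (W.conductorNorm ℤ) K ∧ Odd (NumberField.discr K) ∧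
        NumberField.discr K < -4 ∧ IsKroneckerCharacterOf K εK ∧
        ¬ ‖bernoulliOnePrim (bernoulliCharTwo ψ εK ω)‖ ≤ (p : ℝ)⁻¹ :=
  stubC_of_splitPrimes_bernoulliUnit_six (splitPrimes_bernoulliUnit_six_of_heegnerFamily_six hF)

end Summit.BirchSwinnertonDyer.BirchSwinnertonDyer.Theorems.PrintCFram.HeegnerFieldSupply

end
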